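import Summits.QuantumFields.YangMills.Theorems.BalabanUVNodesN12FlatOneLevelGramExact
import HarnessLib

/-!
# BalabanUVNodes ∕ N12 — (J-b) module H8b: SHARPNESS OF THE EXACT ONE-LEVEL GRAM FLOOR — the alternating data of the coarse torus attain `(L²+2)∕(3L^{d+2})`, so the right-inverse letter
# `3L^{d+2}∕(L²+2)` of module H8 (`…N12FlatOneLevelGramExact`) is OPTIMAL: every preimage `Y`, `QY = g`, of an alternating `g` has `Σ_b Y(b)² ≥ 3L^{d+2}∕(L²+2)·Σ_c g(c)²`

Cell `pub-ymgap` (HUMAN RULINGS D-0062 ∕ D-0149), width seat `pub-ymgap-dag-n10-w1` g5.  `--kind proof --supports stmt-QuantumFields-27364 --as helper` (K1⁹, KEY MAP v2); count-neutral;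
THEOREMS ONLY (0 `def`, 0 `sorry`, 0 `instance`, 0 `notation`).  Companion of module H8 (same seat, same session), split off for the 400-line rule.

THE POINT.  In H8 §3 the only inequality is the pointwise `(pa + qb)² ≥ p(p−q)a² + q(q−p)b²`, an equality iff `b = −a` (for `pq > 0`).  A coarse field with `g⟨y − e_μ, μ⟩ = −g⟨y, μ⟩` for all
`y, μ` (ALTERNATING along each bond's own direction) therefore realises `Σ_b (Qᵗg)(b)² = (L²+2)∕(3L^{d+2})·Σ_c g(c)²` exactly (§1); such fields exist with `g(c)² = 1` everywhere because every
torus `T^{(j+1)}` of the series has `2L^{m+K−j−1}` sites per direction, an EVEN number, so `g⟨y, μ⟩ = (−1)^{label of y_μ}` is consistent around the torus (§2); and for such `g` every `Y`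
with `QY = g` obeys `Σ_c g² = ⟨QY, g⟩ = ⟨Y, Qᵗg⟩ ≤ ‖Y‖·‖Qᵗg‖`, whence `‖Y‖² ≥ Σ_c g²∕c₀ = 3L^{d+2}∕(L²+2)·Σ_c g²` (§1): no right inverse of the one-step straight average `Q` (1.11), linear or
not, has a smaller bond-`ℓ²` letter than H8's — in η-units at one level the OPTIMAL constant is `ρ² = 3L²∕(L²+2) ∈ (1, 3)`.

CONSUMED BY NAME, nothing modified: H8 (`gram_eq_sum_dir`, `sum_sq_eq_sum_dir`, `const_eq`, `sum_offsets_sq_offset`), H5 (`bondAvg_eq_sum_kernel`), `Setup` ∕ `TorusGeometry`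
(`Params.sitesPerDir`, `one_lt_sitesPerDir`, `Site.unshift`), Mathlib (`Finset.sum_mul_sq_le_sq_mul_sq`, `ZMod.val_add`, `Odd.neg_one_pow`).

CONTENTS (ns `Summit.QuantumFields.YangMills.BalabanUVNodes.N12FlatOneLevelGramExactSharp`).  §1 `sum_sq_affine_unshift_eq_of_alternating`, ★★ `gram_eq_of_alternating`,
★★ `letter_floor_of_alternating`.  §2 `exists_alternating_ne_zero`, ★★★ `exists_datum_letter_floor`.

HONEST FRAMING.  Finite-dimensional linear algebra + one-level lattice bookkeeping at the FLAT configuration; real fields; ONE level, whole torus, no comb term, no region; an optimality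
statement about ONE letter of ONE right inverse family — nothing of Bałaban's asserted or denied; the multi-level ∕ reading-(b) ∕ comb Gram floor (print's (46)) stays OPEN and crux-sized;
N12 ∕ N10 NOT discharged; K1⁹ NOT closed; count-neutral (typed 28∕28 · discharged 5∕27 unmoved); one finite 𝕋⁴ programme at fixed ε — R4 closes the conditional finite-𝕋⁴ rung
`BalabanLadder.UV` only; the YM mass gap (Clay) is NOT proved by any of this; nothing continuum ∕ ℝ⁴ ∕ OS.
-/

noncomputable section
open scoped BigOperators
open Finset
namespace Summit.QuantumFields.YangMills.BalabanUVNodes.N12FlatOneLevelGramExactSharp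

open Literature.MathematicalPhysics.QuantumFieldTheory.Balaban1983to89
open LatticeFieldCalculus (bondAvg)
open Summit.QuantumFields.YangMills.BalabanUVNodes.N12FlatOneLevelGramRightInverse (bondAvg_eq_sum_kernel)
open Summit.QuantumFields.YangMills.BalabanUVNodes.N12FlatOneLevelGramExact (gram_eq_sum_dir sum_sq_eq_sum_dir const_eq sum_offsets_sq_offset)

/-! ## §1  The Gram form at alternating data; the cost of their preimages -/

section Sharp

variable {P : Params} {j : ℕ}

/-- At an alternating function (`a(y − e_μ) = −a(y)`) the one-direction inequality of H8 §3 is an EQUALITY (any block side `M`). [folklore] -/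
theorem sum_sq_affine_unshift_eq_of_alternating {i : ℕ} (M : ℕ) (μ : Fin P.d) (a : Site P i → ℝ) (ha : ∀ y, a (y.unshift μ) = -a y) :
    ∑ y : Site P i, ∑ r : Fin P.d → Fin M, ((((r μ : ℕ) : ℝ) + 1) * a y + ((M : ℝ) - 1 - (r μ : ℕ)) * a (y.unshift μ)) ^ 2 =
      ((Fintype.card ({ν : Fin P.d // ν ≠ μ} → Fin M) : ℝ) * ((M : ℝ) * ((M : ℝ) ^ 2 + 2) / 3)) * ∑ y, a y ^ 2 := by
  have hsq : ∀ (y : Site P i) (r : Fin P.d → Fin M),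
      ((((r μ : ℕ) : ℝ) + 1) * a y + ((M : ℝ) - 1 - (r μ : ℕ)) * a (y.unshift μ)) ^ 2 = (2 * ((r μ : ℕ) : ℝ) + 2 - M) ^ 2 * a y ^ 2 := fun y r => by
    rw [ha]; ring
  simp only [hsq, ← Finset.sum_mul, sum_offsets_sq_offset M μ]
  rw [Finset.mul_sum]

/-- ★★ **THE GRAM FORM ATTAINS THE FLOOR AT EVERY ALTERNATING DATUM** `g⟨y − e_μ, μ⟩ = −g⟨y, μ⟩`: `Σ_b (Qᵗg)(b)² = (L²+2)∕(3L^{d+2})·Σ_c g(c)²`. [cite: Balaban1985Variational, (44)-(46) p.285] -/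
theorem gram_eq_of_alternating [DecidableEq (PBond P j)] (hj : j + 1 ≤ P.m + P.K) (g : VecField P (j + 1) ℝ)
    (hg : ∀ (y : Site P (j + 1)) (μ : Fin P.d), g ⟨y.unshift μ, μ⟩ = -g ⟨y, μ⟩) :
    ∑ b : PBond P j, (∑ c, bondAvg (Pi.single b (1 : ℝ)) c * g c) ^ 2 = ((P.L : ℝ) ^ 2 + 2) / (3 * (P.L : ℝ) ^ (P.d + 2)) * ∑ c, g c ^ 2 := by
  rw [gram_eq_sum_dir hj g, sum_sq_eq_sum_dir g, Finset.mul_sum]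
  refine Finset.sum_congr rfl fun μ _ => ?_
  rw [const_eq (P := P) P.L_pos.ne' μ, mul_assoc, sum_sq_affine_unshift_eq_of_alternating P.L μ (fun y => g ⟨y, μ⟩) (fun y => hg y μ)]

/-- ★★ **EVERY PREIMAGE OF AN ALTERNATING DATUM COSTS THE FULL LETTER**: if `g⟨y − e_μ, μ⟩ = −g⟨y, μ⟩` and `QY = g` then `3L^{d+2}∕(L²+2)·Σ_c g(c)² ≤ Σ_b Y(b)²`
(`Σ_c g² = ⟨QY, g⟩ = ⟨Y, Qᵗg⟩ ≤ ‖Y‖·‖Qᵗg‖` and `‖Qᵗg‖² = (L²+2)∕(3L^{d+2})·Σ g²`) — so the letter of H8 §4 cannot be improved, not even datum by datum along the alternating directions.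
[cite: Balaban1985Variational, (44)-(46) p.285; Balaban1984PropagatorsI, (1.11) p.19] -/
theorem letter_floor_of_alternating (hj : j + 1 ≤ P.m + P.K) (g : VecField P (j + 1) ℝ)
    (hg : ∀ (y : Site P (j + 1)) (μ : Fin P.d), g ⟨y.unshift μ, μ⟩ = -g ⟨y, μ⟩) (Y : VecField P j ℝ) (hY : bondAvg Y = g) :
    (3 * (P.L : ℝ) ^ (P.d + 2) / ((P.L : ℝ) ^ 2 + 2)) * ∑ c, g c ^ 2 ≤ ∑ b, Y b ^ 2 := by
  classical
  have hL : (0 : ℝ) < (P.L : ℝ) := Nat.cast_pos.mpr P.L_pos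
  set c₀ : ℝ := ((P.L : ℝ) ^ 2 + 2) / (3 * (P.L : ℝ) ^ (P.d + 2)) with hc₀
  have hc₀pos : 0 < c₀ := by positivity
  set T : PBond P j → ℝ := fun b => ∑ c, bondAvg (Pi.single b (1 : ℝ)) c * g c with hT
  set S : ℝ := ∑ c, g c ^ 2 with hS
  have hS0 : 0 ≤ S := Finset.sum_nonneg fun c _ => sq_nonneg _
  -- `S = Σ_b Y(b)·T(b)`
  have hSY : S = ∑ b, Y b * T b := by
    have h1 : S = ∑ c, bondAvg Y c * g c := by
      rw [hS, hY]; exact Finset.sum_congr rfl fun c _ => by ring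
    have h2 : ∀ c, bondAvg Y c = ∑ b, bondAvg (Pi.single b (1 : ℝ)) c * Y b := fun c => bondAvg_eq_sum_kernel Y c
    rw [h1]
    simp only [h2, hT, Finset.sum_mul, Finset.mul_sum]
    rw [Finset.sum_comm]
    exact Finset.sum_congr rfl fun b _ => Finset.sum_congr rfl fun c _ => by ring
  have hTT : ∑ b, T b ^ 2 = c₀ * S := gram_eq_of_alternating hj g hg
  have hCS : S ^ 2 ≤ (∑ b, Y b ^ 2) * ∑ b, T b ^ 2 := by rw [hSY]; exact Finset.sum_mul_sq_le_sq_mul_sq _ _ _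
  rw [hTT] at hCS
  have hinv : 3 * (P.L : ℝ) ^ (P.d + 2) / ((P.L : ℝ) ^ 2 + 2) = c₀⁻¹ := by rw [hc₀, inv_div]
  rw [hinv]
  by_cases hS' : S = 0
  · rw [hS', mul_zero]; exact Finset.sum_nonneg fun b _ => sq_nonneg _
  · have hSpos : 0 < S := lt_of_le_of_ne hS0 (Ne.symm hS')
    have h2 : S * S ≤ ((∑ b, Y b ^ 2) * c₀) * S := by
      calc S * S = S ^ 2 := (sq S).symm
        _ ≤ (∑ b, Y b ^ 2) * (c₀ * S) := hCS
        _ = ((∑ b, Y b ^ 2) * c₀) * S := by ring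
    have h3 : S ≤ (∑ b, Y b ^ 2) * c₀ := le_of_mul_le_mul_right h2 hSpos
    calc c₀⁻¹ * S ≤ c₀⁻¹ * ((∑ b, Y b ^ 2) * c₀) := mul_le_mul_of_nonneg_left h3 (by positivity)
      _ = ∑ b, Y b ^ 2 := by field_simp

/-! ## §2  Alternating data exist; optimality of the letter -/

/-- **Alternating data exist and are non-zero**: every torus of the series has an EVEN number `2L^{m+K−j−1}` of sites per direction, so `g⟨y, μ⟩ = (−1)^{y_μ}` is well defined with
`g⟨y − e_μ, μ⟩ = −g⟨y, μ⟩`. [cite: Balaban1987RG1, (0.1) p.251] -/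
theorem exists_alternating_ne_zero (P : Params) (j : ℕ) :
    ∃ g : VecField P (j + 1) ℝ, (∀ (y : Site P (j + 1)) (μ : Fin P.d), g ⟨y.unshift μ, μ⟩ = -g ⟨y, μ⟩) ∧ ∀ c, g c ^ 2 = 1 := by
  refine ⟨fun c => (-1 : ℝ) ^ (c.src c.dir).val, fun y μ => ?_, fun c => ?_⟩
  · -- parity along `μ`
    set n : ℕ := P.sitesPerDir (j + 1) with hn
    have hne : Even n := by rw [hn]; unfold Params.sitesPerDir; exact even_two_mul _
    have hn2 : 2 ≤ n := P.one_lt_sitesPerDir (j + 1)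
    set v : ZMod n := y μ with hv
    have huv : (y.unshift μ) μ = v - 1 := by simp only [Site.unshift, Function.update_self, hv]
    show (-1 : ℝ) ^ ((y.unshift μ) μ).val = -(-1 : ℝ) ^ (y μ).val
    rw [huv, ← hv]
    set w : ℕ := (v - 1).val with hw
    have hwlt : w < n := ZMod.val_lt _
    have hval : v.val = (w + 1) % n := by
      have : v = (v - 1) + 1 := by ring
      conv_lhs => rw [this]
      rw [ZMod.val_add, ZMod.val_one]
    by_cases hlast : w + 1 = n
    · rw [hval, hlast, Nat.mod_self, pow_zero]
      have hodd : Odd w := by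
        have : w = n - 1 := by omega
        rw [this]
        exact Nat.Even.sub_odd (by omega) hne odd_one
      rw [hodd.neg_one_pow]
    · rw [hval, Nat.mod_eq_of_lt (by omega), pow_succ]
      ring
  · rw [← pow_mul]
    exact Even.neg_one_pow ⟨(c.src c.dir).val, by ring⟩

/-- ★★★ **OPTIMALITY OF THE ONE-LEVEL LETTER**: there is a coarse field `g ≠ 0` (indeed `g(c)² = 1` everywhere) all of whose preimages under the straight average cost the full letter:
`QY = g → 3L^{d+2}∕(L²+2)·Σ_c g(c)² ≤ Σ_b Y(b)²`; so no right inverse of `Q`, linear or not, beats H8 §4's `3L^{d+2}∕(L²+2)` (for `L•Q`: `3L^d∕(L²+2)`; in η-units `ρ² ≥ 3L²∕(L²+2) > 1` for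
the OPTIMAL inverse, `< 3` by H8 §4). [cite: Balaban1985Variational, (44)-(46) p.285; Balaban1984PropagatorsI, (1.11) p.19] -/
theorem exists_datum_letter_floor (hj : j + 1 ≤ P.m + P.K) :
    ∃ g : VecField P (j + 1) ℝ, (∀ c, g c ^ 2 = 1) ∧
      ∀ Y : VecField P j ℝ, bondAvg Y = g → (3 * (P.L : ℝ) ^ (P.d + 2) / ((P.L : ℝ) ^ 2 + 2)) * ∑ c, g c ^ 2 ≤ ∑ b, Y b ^ 2 := by
  obtain ⟨g, hg, hg1⟩ := exists_alternating_ne_zero P j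
  exact ⟨g, hg1, fun Y hY => letter_floor_of_alternating hj g hg Y hY⟩

end Sharp

end Summit.QuantumFields.YangMills.BalabanUVNodes.N12FlatOneLevelGramExactSharp
end
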